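import Literature.Computability.Complexity.GateEliminationAffineGates

/-!
# Gate elimination, XVIII: closed sets of gates, sub-circuits, topologically minimal ∧-gates

Toolkit for the one-step claim `LiYang2022_step` (Li–Yang, STOC 2022; full version
ECCC TR21-023, §2.6: "Let `G` be a topologically minimal ∧-type gate fed by `I₁` and `I₂`, where
`I₁` is a gate. The subcircuit computing `I₁` does not involve ∧-type gates, so that it is a
cyclic xor-circuit"; Prop. 2.7). Everything is PROVED, without matrices.

* `IsClosed S` (gates of `S` read only gates of `S`), `ConsistentOn S` (their equations);
  `isClosed_xorPart`, `IsClosed.inter_xorPart`.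
* `tMap` — the self-map of the equations of a set of gates; for a closed `T ⊆ xorPart` it is
  the restriction of `xorMap` (`tMap_restrict`), hence injective under fairness
  (`Fair.tMap_injective`: a non-injective self-map of a finite set misses a value that the
  surjective `xorMap` hits), so solutions on `T` are unique
  (`Fair.consistentOn_unique_of_subset_xorPart`); by induction on the rank this extends to
  **every closed set of gates** (`Fair.consistentOn_unique`): the sub-circuit on a closed set is
  uniquely solvable by itself.
* `ConsistentOn.xor3_of_affine`, **`sol_xorAffine_of_closed_affine`**, `nodeFn`,
  `nodeFn_xorAffine` — a closed set of affine gates (`IsAffineOp`) computes xor-affine functions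
  of the input at each of its gates.
* `preds`, `predStep`, `predIter`, **`ancestors`** (the least closed set containing a set of
  gates: `isClosed_ancestors`, `subset_ancestors`, `ancestors_subset_of_isClosed`),
  `strictAncestors`, `not_mem_strictAncestors_self` (no gate of the acyclic part is its own strict
  ancestor), `IsTopMinAnd` and **`exists_isTopMinAnd`**: a circuit with an ∧-type gate has a
  topologically minimal one (fewest strict ancestors).

With `exists_isAndOp` (`GateEliminationAffineGates.lean`) this gives, for a fair semicircuit
computing an affine disperser on a source of dimension `≥ 2d + 1`, a topologically minimal ∧-type
gate whose inputs compute xor-affine functions (`nodeFn_xorAffine` on `strictAncestors`).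

## References

* J. Li, T. Yang, *3.1n − o(n) circuit lower bounds for explicit functions*, STOC 2022
  [LiYang2022]; full version ECCC TR21-023, Def. 2.5, §2.5, §2.6, Prop. 2.7.
-/

namespace Literature.Computability.Complexity

open Finset

namespace Semicircuit

variable {n : ℕ} (C : Semicircuit n)

/-! ### Closed sets of gates -/

/-- A set of gates is **closed** (under predecessors): its gates read only variables, constants,
and gates of the set — the gates of a sub-circuit ("the subcircuit computing `I₁`", Li–Yang §2.6).
[cite: LiYang2022, §2.6] -/
def IsClosed (S : Finset (Fin C.m)) : Prop :=
  ∀ k ∈ S, ∀ (a : Fin 2) (k' : Fin C.m), C.arg k a = .gate k' → k' ∈ S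

/-- The equations of the gates of `S` hold. [cite: LiYang2022, §2.5] -/
def ConsistentOn (S : Finset (Fin C.m)) (x : Fin n → Bool) (w : Fin C.m → Bool) : Prop :=
  ∀ k ∈ S, C.GateEq x w k

variable {C} in
/-- On a closed set, the equations only see the values on the set. [folklore] -/
theorem ConsistentOn.congr {S : Finset (Fin C.m)} (hS : C.IsClosed S) {x : Fin n → Bool}
    {w w' : Fin C.m → Bool} (hw : C.ConsistentOn S x w) (h : ∀ k ∈ S, w' k = w k) : C.ConsistentOn S x w' := by
  intro k hk
  unfold GateEq
  rw [h k hk, hw k hk]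
  congr 1
  · exact C.nodeVal_congr x fun j hj => (h j (hS k hk 0 j hj)).symm
  · exact C.nodeVal_congr x fun j hj => (h j (hS k hk 1 j hj)).symm

/-- The whole set of gates is closed. [folklore] -/
theorem isClosed_univ : C.IsClosed univ := fun _ _ _ _ _ => mem_univ _

/-- The xor-part is closed. [cite: LiYang2022, Def. 2.5] -/
theorem isClosed_xorPart : C.IsClosed C.xorPart := fun k hk a k' h => C.mem_of_arg_eq k hk a k' h

variable {C} in
/-- The part of a closed set inside the xor-part is closed (xor-part gates read only xor-part
gates). [folklore] -/
theorem IsClosed.inter_xorPart {S : Finset (Fin C.m)} (hS : C.IsClosed S) : C.IsClosed (S ∩ C.xorPart) := by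
  intro k hk a k' h
  rw [mem_inter] at hk ⊢
  exact ⟨hS k hk.1 a k' h, C.mem_of_arg_eq k hk.2 a k' h⟩

/-! ### The self-map of a closed subset of the xor-part -/

/-- Values on a set of gates, extended by `false`. [folklore] -/
def extendT (T : Finset (Fin C.m)) (u : T → Bool) : Fin C.m → Bool :=
  fun j => if h : j ∈ T then u ⟨j, h⟩ else false

/-- `extendT` on the set. [folklore] -/
theorem extendT_apply_mem (T : Finset (Fin C.m)) (u : T → Bool) {j : Fin C.m} (h : j ∈ T) :
    C.extendT T u j = u ⟨j, h⟩ := by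
  simp [extendT, h]

/-- The self-map of the equations of a set `T` of gates (meant for a closed subset of the
xor-part): `u ↦ u ⊕ right-hand sides`. [cite: LiYang2022, §2.5] -/
def tMap (T : Finset (Fin C.m)) (x : Fin n → Bool) (u : T → Bool) : T → Bool :=
  fun k => u k ^^ C.op k (C.nodeVal x (C.extendT T u) (C.arg k 0)) (C.nodeVal x (C.extendT T u) (C.arg k 1))

/-- Zeros of the self-map are the solutions of the equations of `T`. [folklore] -/
theorem tMap_eq_false_iff (T : Finset (Fin C.m)) (x : Fin n → Bool) (u : T → Bool) :
    (∀ k, C.tMap T x u k = false) ↔ C.ConsistentOn T x (C.extendT T u) := by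
  constructor
  · intro h j hj
    have := h ⟨j, hj⟩
    unfold tMap at this
    unfold GateEq
    rw [C.extendT_apply_mem T u hj]
    revert this
    generalize u ⟨j, hj⟩ = a
    generalize C.op j _ _ = b
    cases a <;> cases b <;> simp
  · intro h ⟨j, hj⟩
    have := h j hj
    unfold GateEq at this
    unfold tMap
    rw [C.extendT_apply_mem T u hj] at this
    rw [← this]
    simp

/-- **Restriction**: for a closed `T ⊆ xorPart`, the self-map of `T` is the restriction of the
self-map of the xor-part. [folklore] -/
theorem tMap_restrict {T : Finset (Fin C.m)} (hT : C.IsClosed T) (hTK : T ⊆ C.xorPart) (x : Fin n → Bool)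
    (u : C.KVec) (k : T) :
    C.tMap T x (fun k => u ⟨k, hTK k.2⟩) k = C.xorMap x u ⟨k, hTK k.2⟩ := by
  unfold tMap xorMap
  have key : ∀ a, C.nodeVal x (C.extendT T fun k => u ⟨k, hTK k.2⟩) (C.arg k a) =
      C.nodeVal x (C.extendK u) (C.arg k a) := by
    intro a
    refine C.nodeVal_congr x fun j hj => ?_
    have hjT : j ∈ T := hT k k.2 a j hj
    rw [C.extendT_apply_mem T _ hjT, C.extendK_apply_mem u (hTK hjT)]
  rw [key 0, key 1]

variable {C} in
/-- **Under fairness, the self-map of a closed subset of the xor-part is injective** (a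
non-injective self-map of a finite set misses a value, which the surjective self-map of the
whole xor-part would hit). [cite: LiYang2022, §2.5] -/
theorem Fair.tMap_injective (hF : C.Fair) {T : Finset (Fin C.m)} (hT : C.IsClosed T) (hTK : T ⊆ C.xorPart)
    (x : Fin n → Bool) : Function.Injective (C.tMap T x) := by
  classical
  by_contra hinj
  have hsurj : ¬ Function.Surjective (C.tMap T x) := fun h => hinj (Finite.injective_iff_surjective.mpr h)
  apply hsurj
  intro t
  -- hit an extension of `t` by the self-map of the whole xor-part
  obtain ⟨u, hu⟩ := hF.xorMap_surjective x fun k => if h : (k : Fin C.m) ∈ T then t ⟨k, h⟩ else false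
  refine ⟨fun k => u ⟨k, hTK k.2⟩, funext fun k => ?_⟩
  rw [C.tMap_restrict hT hTK x u k, hu]
  simp [k.2]

variable {C} in
/-- Hence **solutions of the equations of a closed subset of the xor-part are unique** on it.
[cite: LiYang2022, §2.5] -/
theorem Fair.consistentOn_unique_of_subset_xorPart (hF : C.Fair) {T : Finset (Fin C.m)} (hT : C.IsClosed T)
    (hTK : T ⊆ C.xorPart) {x : Fin n → Bool} {w w' : Fin C.m → Bool}
    (hw : C.ConsistentOn T x w) (hw' : C.ConsistentOn T x w') : ∀ k ∈ T, w k = w' k := by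
  -- restrict both to `T`
  have h1 : C.ConsistentOn T x (C.extendT T fun k => w k) :=
    hw.congr hT fun k hk => C.extendT_apply_mem T _ hk
  have h2 : C.ConsistentOn T x (C.extendT T fun k => w' k) :=
    hw'.congr hT fun k hk => C.extendT_apply_mem T _ hk
  rw [← tMap_eq_false_iff] at h1 h2
  have heq : C.tMap T x (fun k => w k) = C.tMap T x (fun k => w' k) := by
    funext k; rw [h1 k, h2 k]
  have := hF.tMap_injective hT hTK x heq
  intro k hk
  exact congrFun this ⟨k, hk⟩

/-! ### Unique solvability on any closed set of gates -/

variable {C} in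
/-- **Solutions of the equations of a closed set of gates are unique on it** (under fairness):
on its xor-part by the previous lemma, on its acyclic part by induction on the rank.
[cite: LiYang2022, §2.5] -/
theorem Fair.consistentOn_unique (hF : C.Fair) {S : Finset (Fin C.m)} (hS : C.IsClosed S)
    {x : Fin n → Bool} {w w' : Fin C.m → Bool} (hw : C.ConsistentOn S x w) (hw' : C.ConsistentOn S x w') :
    ∀ k ∈ S, w k = w' k := by
  -- first on `S ∩ xorPart`
  have hK : ∀ k ∈ S ∩ C.xorPart, w k = w' k :=
    hF.consistentOn_unique_of_subset_xorPart hS.inter_xorPart inter_subset_right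
      (fun k hk => hw k (mem_inter.mp hk).1) (fun k hk => hw' k (mem_inter.mp hk).1)
  -- then by strong induction on the rank for the acyclic part
  suffices key : ∀ t k, C.rank k < t → k ∈ S → w k = w' k by
    intro k hk; exact key _ k (Nat.lt_succ_self _) hk
  intro t
  induction t with
  | zero => intro k h; exact absurd h (Nat.not_lt_zero _)
  | succ t ih =>
    intro k hkt hk
    by_cases hkK : k ∈ C.xorPart
    · exact hK k (mem_inter.mpr ⟨hk, hkK⟩)
    · have e1 := hw k hk
      have e2 := hw' k hk
      unfold GateEq at e1 e2
      rw [e1, e2]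
      have hin : ∀ a, C.nodeVal x w (C.arg k a) = C.nodeVal x w' (C.arg k a) := by
        intro a
        refine C.nodeVal_congr x fun j hj => ?_
        have hjS : j ∈ S := hS k hk a j hj
        by_cases hjK : j ∈ C.xorPart
        · exact hK j (mem_inter.mpr ⟨hjS, hjK⟩)
        · exact ih j (by have := C.rank_lt hkK hj hjK; omega) hjS
      rw [hin 0, hin 1]

/-! ### Closed sets of affine gates compute affine functions -/

variable {C} in
/-- On a closed set of affine gates, the equations are affine: the xor of three solutions (on
three inputs) is a solution on the xor of the inputs. [cite: LiYang2022, §2.6] -/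
theorem ConsistentOn.xor3_of_affine {S : Finset (Fin C.m)} (haff : ∀ k ∈ S, IsAffineOp (C.op k))
    {x₁ x₂ x₃ : Fin n → Bool} {w₁ w₂ w₃ : Fin C.m → Bool}
    (h₁ : C.ConsistentOn S x₁ w₁) (h₂ : C.ConsistentOn S x₂ w₂) (h₃ : C.ConsistentOn S x₃ w₃) :
    C.ConsistentOn S (xor3 x₁ x₂ x₃) (xor3 w₁ w₂ w₃) := by
  intro j hj
  obtain ⟨s₀, s₁, c, hc⟩ := haff j hj
  unfold GateEq
  rw [nodeVal_xor3, nodeVal_xor3, hc]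
  show ((w₁ j ^^ w₂ j) ^^ w₃ j) = _
  have e1 := h₁ j hj; have e2 := h₂ j hj; have e3 := h₃ j hj
  unfold GateEq at e1 e2 e3
  rw [e1, e2, e3, hc, hc, hc]
  generalize C.nodeVal x₁ w₁ (C.arg j 0) = a₁
  generalize C.nodeVal x₂ w₂ (C.arg j 0) = a₂
  generalize C.nodeVal x₃ w₃ (C.arg j 0) = a₃
  generalize C.nodeVal x₁ w₁ (C.arg j 1) = b₁
  generalize C.nodeVal x₂ w₂ (C.arg j 1) = b₂
  generalize C.nodeVal x₃ w₃ (C.arg j 1) = b₃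
  cases a₁ <;> cases a₂ <;> cases a₃ <;> cases b₁ <;> cases b₂ <;> cases b₃ <;> cases s₀ <;> cases s₁ <;> cases c <;> rfl

/-- **A closed set of affine gates of a fair semicircuit computes xor-affine functions**: for
every gate `k` of the set, `x ↦ sol x k` is xor-affine (Li–Yang §2.6: "the subcircuit computing
`I₁` does not involve ∧-type gates, so that it is a cyclic xor-circuit … computing an affine
function"). [cite: LiYang2022, §2.6, Prop. 2.7] -/
theorem sol_xorAffine_of_closed_affine (hF : C.Fair) {S : Finset (Fin C.m)} (hS : C.IsClosed S)
    (haff : ∀ k ∈ S, IsAffineOp (C.op k)) {k : Fin C.m} (hk : k ∈ S) :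
    IsXorAffine fun x => C.sol hF x k := by
  intro x₁ x₂ x₃
  have hc : ∀ x, C.ConsistentOn S x (C.sol hF x) := fun x j _ => C.consistent_sol hF x j
  have h := (hc x₁).xor3_of_affine haff (hc x₂) (hc x₃)
  exact hF.consistentOn_unique hS (hc _) h k hk

/-- The value of a node, as a function of the input, for a fair semicircuit. [cite: LiYang2022, §2.5] -/
noncomputable def nodeFn (hF : C.Fair) (v : Node n C.m) (x : Fin n → Bool) : Bool := C.nodeVal x (C.sol hF x) v

/-- Variables and constants are xor-affine functions of the input. [folklore] -/
theorem nodeFn_xorAffine_of_not_gate (hF : C.Fair) {v : Node n C.m} (hv : ∀ k, v ≠ .gate k) :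
    IsXorAffine (C.nodeFn hF v) := by
  intro x₁ x₂ x₃
  cases v with
  | const b => cases b <;> rfl
  | var i => rfl
  | gate k => exact absurd rfl (hv k)

/-- **A node all of whose gate-ancestors are affine computes a xor-affine function.**
[cite: LiYang2022, §2.6] -/
theorem nodeFn_xorAffine (hF : C.Fair) {S : Finset (Fin C.m)} (hS : C.IsClosed S)
    (haff : ∀ k ∈ S, IsAffineOp (C.op k)) {v : Node n C.m} (hv : ∀ k, v = .gate k → k ∈ S) :
    IsXorAffine (C.nodeFn hF v) := by
  cases v with
  | const b => exact C.nodeFn_xorAffine_of_not_gate hF fun k h => by cases h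
  | var i => exact C.nodeFn_xorAffine_of_not_gate hF fun k h => by cases h
  | gate k => exact C.sol_xorAffine_of_closed_affine hF hS haff (hv k rfl)


/-! ### Gate-ancestors -/

/-- The gates read by gate `k`. [folklore] -/
def preds (k : Fin C.m) : Finset (Fin C.m) := univ.filter fun k' => ∃ a, C.arg k a = .gate k'

/-- One step of predecessor closure. [folklore] -/
def predStep (S : Finset (Fin C.m)) : Finset (Fin C.m) := S ∪ S.biUnion C.preds

/-- Iterated predecessor closure. [folklore] -/
def predIter (S : Finset (Fin C.m)) : ℕ → Finset (Fin C.m)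
  | 0 => S
  | t + 1 => C.predStep (predIter S t)

/-- The **gate-ancestors** of a set of gates: the least closed set of gates containing it
(`m` closure steps suffice). [cite: LiYang2022, §2.6] -/
def ancestors (S : Finset (Fin C.m)) : Finset (Fin C.m) := C.predIter S C.m

/-- `S ⊆ predStep S`. [folklore] -/
theorem subset_predStep (S : Finset (Fin C.m)) : S ⊆ C.predStep S := subset_union_left

/-- `predIter` is monotone in the number of steps. [folklore] -/
theorem predIter_mono (S : Finset (Fin C.m)) : ∀ t, C.predIter S t ⊆ C.predIter S (t + 1) :=
  fun _ => C.subset_predStep _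

/-- `S ⊆ predIter S t`. [folklore] -/
theorem subset_predIter (S : Finset (Fin C.m)) : ∀ t, S ⊆ C.predIter S t
  | 0 => subset_rfl
  | t + 1 => (subset_predIter S t).trans (C.predIter_mono S t)

/-- A closed set is a fixed point of the closure step. [folklore] -/
theorem predStep_eq_of_isClosed {S : Finset (Fin C.m)} (hS : C.IsClosed S) : C.predStep S = S := by
  refine le_antisymm (union_subset subset_rfl fun k hk => ?_) (C.subset_predStep S)
  rw [mem_biUnion] at hk
  obtain ⟨k', hk', hkk⟩ := hk
  unfold preds at hkk
  rw [mem_filter] at hkk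
  obtain ⟨a, ha⟩ := hkk.2
  exact hS k' hk' a k ha

/-- `predIter` stays inside any closed superset. [folklore] -/
theorem predIter_subset_of_isClosed {S T : Finset (Fin C.m)} (hST : S ⊆ T) (hT : C.IsClosed T) :
    ∀ t, C.predIter S t ⊆ T
  | 0 => hST
  | t + 1 => by
    show C.predStep (C.predIter S t) ⊆ T
    rw [← C.predStep_eq_of_isClosed hT]
    exact union_subset_union (predIter_subset_of_isClosed hST hT t)
      (biUnion_subset_biUnion_of_subset_left _ (predIter_subset_of_isClosed hST hT t))

/-- If a closure step adds nothing, the set is closed. [folklore] -/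
theorem isClosed_of_predStep_eq {S : Finset (Fin C.m)} (h : C.predStep S = S) : C.IsClosed S := by
  intro k hk a k' hk'
  rw [← h]
  refine mem_union_right _ (mem_biUnion.mpr ⟨k, hk, ?_⟩)
  unfold preds; rw [mem_filter]; exact ⟨mem_univ _, a, hk'⟩

/-- After `m` steps the closure is closed (each strict step adds a gate). [folklore] -/
theorem isClosed_ancestors (S : Finset (Fin C.m)) : C.IsClosed (C.ancestors S) := by
  classical
  -- if some step before `m` is a fixed point we are done; otherwise the cardinality exceeds `m`
  by_contra hnot
  have hstrict : ∀ t ≤ C.m, t ≤ (C.predIter S t).card := by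
    intro t
    induction t with
    | zero => intro _; exact Nat.zero_le _
    | succ t ih =>
      intro ht
      have ih' := ih (by omega)
      have hne : C.predStep (C.predIter S t) ≠ C.predIter S t := by
        intro heq
        -- then all later iterates are equal, in particular `ancestors S` is closed
        have hfix : ∀ s, C.predIter S (t + s) = C.predIter S t := by
          intro s
          induction s with
          | zero => rfl
          | succ s ihs => show C.predStep (C.predIter S (t + s)) = _; rw [ihs, heq]
        apply hnot
        have : C.ancestors S = C.predIter S t := by
          unfold ancestors
          have := hfix (C.m - t)
          rwa [Nat.add_sub_cancel' (by omega)] at this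
        rw [this]
        exact C.isClosed_of_predStep_eq heq
      have hlt : (C.predIter S t).card < (C.predIter S (t + 1)).card :=
        card_lt_card ((C.subset_predStep _).ssubset_of_ne (Ne.symm hne))
      omega
  have := hstrict C.m le_rfl
  have hle : (C.predIter S C.m).card ≤ C.m := (card_le_univ _).trans (by simp)
  -- equality forces the set to be everything, which is closed
  apply hnot
  have hall : C.ancestors S = univ := by
    apply eq_univ_of_card
    unfold ancestors
    have : (C.predIter S C.m).card = C.m := le_antisymm hle this
    rw [this, Fintype.card_fin]
  rw [hall]
  exact C.isClosed_univ

/-- The ancestors contain the set. [folklore] -/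
theorem subset_ancestors (S : Finset (Fin C.m)) : S ⊆ C.ancestors S := C.subset_predIter S C.m

/-- **Minimality**: the ancestors lie in every closed superset. [folklore] -/
theorem ancestors_subset_of_isClosed {S T : Finset (Fin C.m)} (hST : S ⊆ T) (hT : C.IsClosed T) :
    C.ancestors S ⊆ T :=
  C.predIter_subset_of_isClosed hST hT C.m

/-- Ancestors are monotone. [folklore] -/
theorem ancestors_mono {S T : Finset (Fin C.m)} (hST : S ⊆ T) : C.ancestors S ⊆ C.ancestors T :=
  C.ancestors_subset_of_isClosed (hST.trans (C.subset_ancestors T)) (C.isClosed_ancestors T)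

/-- The *strict ancestors* of gate `k`: the ancestors of the gates it reads. [folklore] -/
def strictAncestors (k : Fin C.m) : Finset (Fin C.m) := C.ancestors (C.preds k)

/-- **No gate of the acyclic part is its own strict ancestor** (a cycle through a gate outside
the xor-part is impossible: xor-part gates read only xor-part gates, and the rank decreases along
the other wires). [cite: LiYang2022, Def. 2.5] -/
theorem not_mem_strictAncestors_self {k : Fin C.m} (hk : k ∉ C.xorPart) : k ∉ C.strictAncestors k := by
  -- the closed set of gates that are in the xor-part or of rank `< rank k` contains `preds k`
  classical
  set T : Finset (Fin C.m) := univ.filter fun j => j ∈ C.xorPart ∨ C.rank j < C.rank k with hT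
  have hTclosed : C.IsClosed T := by
    intro j hj a j' hj'
    rw [hT, mem_filter] at hj ⊢
    refine ⟨mem_univ _, ?_⟩
    rcases hj.2 with hjK | hjr
    · exact Or.inl (C.mem_of_arg_eq j hjK a j' hj')
    · by_cases hj'K : j' ∈ C.xorPart
      · exact Or.inl hj'K
      · have hjK : j ∉ C.xorPart := fun h => hj'K (C.mem_of_arg_eq j h a j' hj')
        exact Or.inr ((C.rank_lt hjK hj' hj'K).trans hjr)
  have hpreds : C.preds k ⊆ T := by
    intro j hj
    unfold preds at hj
    rw [mem_filter] at hj
    obtain ⟨a, ha⟩ := hj.2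
    rw [hT, mem_filter]
    refine ⟨mem_univ _, ?_⟩
    by_cases hjK : j ∈ C.xorPart
    · exact Or.inl hjK
    · exact Or.inr (C.rank_lt hk ha hjK)
  intro hmem
  have := C.ancestors_subset_of_isClosed hpreds hTclosed hmem
  rw [hT, mem_filter] at this
  rcases this.2 with h | h
  · exact hk h
  · exact lt_irrefl _ h

/-- A gate is **topologically minimal ∧-type**: ∧-type, and none of its strict ancestors is
∧-type (Li–Yang §2.6: "a topologically minimal ∧-type gate … the subcircuit computing `I₁` does
not involve ∧-type gates"). [cite: LiYang2022, §2.6] -/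
def IsTopMinAnd (G : Fin C.m) : Prop :=
  IsAndOp (C.op G) ∧ ∀ k ∈ C.strictAncestors G, ¬ IsAndOp (C.op k)

/-- Strict ancestors of a strict ancestor are strict ancestors. [folklore] -/
theorem strictAncestors_subset_of_mem {G k : Fin C.m} (hk : k ∈ C.strictAncestors G) :
    C.strictAncestors k ⊆ C.strictAncestors G := by
  refine C.ancestors_subset_of_isClosed (fun j hj => ?_) (C.isClosed_ancestors _)
  unfold preds at hj
  rw [mem_filter] at hj
  obtain ⟨a, ha⟩ := hj.2
  exact C.isClosed_ancestors _ k hk a j ha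

/-- **A circuit with an ∧-type gate has a topologically minimal one** (take an ∧-type gate with
the fewest strict ancestors: an ∧-type strict ancestor would have strictly fewer, not being its
own strict ancestor). [cite: LiYang2022, §2.6] -/
theorem exists_isTopMinAnd {G₀ : Fin C.m} (h₀ : IsAndOp (C.op G₀)) : ∃ G, C.IsTopMinAnd G := by
  classical
  -- minimize the number of strict ancestors over ∧-type gates
  obtain ⟨G, hG, hmin⟩ := exists_min_image (univ.filter fun G => IsAndOp (C.op G))
    (fun G => (C.strictAncestors G).card) ⟨G₀, mem_filter.mpr ⟨mem_univ _, h₀⟩⟩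
  rw [mem_filter] at hG
  refine ⟨G, hG.2, fun k hk hand => ?_⟩
  have hle := hmin k (mem_filter.mpr ⟨mem_univ _, hand⟩)
  have hsub := C.strictAncestors_subset_of_mem hk
  have hkK : k ∉ C.xorPart := fun hK => by
    -- an ∧-type function is not ⊕-type
    obtain ⟨c, hc⟩ := C.isXorOp_of_mem k hK
    obtain ⟨c₁, c₂, c₃, ha⟩ := hand
    have h00 := (ha false false).symm.trans (hc false false)
    have h01 := (ha false true).symm.trans (hc false true)
    have h10 := (ha true false).symm.trans (hc true false)
    have h11 := (ha true true).symm.trans (hc true true)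
    revert h00 h01 h10 h11
    cases c₁ <;> cases c₂ <;> cases c₃ <;> cases c <;> simp
  have hkk : k ∉ C.strictAncestors k := C.not_mem_strictAncestors_self hkK
  have hlt : (C.strictAncestors k).card < (C.strictAncestors G).card :=
    card_lt_card (hsub.ssubset_of_ne fun heq => hkk (heq ▸ hk))
  omega

end Semicircuit

end Literature.Computability.Complexity
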